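import Literature.Barriers.CriticalPhenomena.PlaquetteWalkHoleRootExtremeRunShape
import HarnessLib

/-!
# Barrier catalogue (SAWScalingLimit): the initial straight run of a walk from a hole root along the hole row, the first hit of a
root-row rhombus, and the slanted end it forces at limit cost `5` («INITIAL RUN»)

Third structural brick of the «RECTANGLE COEFFICIENT» classification (after `PlaquetteWalkHoleRootExtremeRowGap` and
`PlaquetteWalkHoleRootExtremeRunShape`), for the cells of the ROOT ROW `r = (w.1 + k, w.2)` east of the root plaquette `w` (hole
`(w.1 − 1, w.2)` absent, root `a = w.side W`):

* `YBWalk.sIn_zero_eq_W` (the first arc enters `w` through `W`) and ★ `YBWalk.initial_run`: if the first `k` arcs are straight they run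
  EAST along the hole row — arc `i` lies in `(w.1 + i, w.2)`, enters through `W`, leaves through `E`.
* ★ `ΩG.firstHitG_eq_of_initial_run`: then `∂r` is first crossed at index `k`, through `r`'s `W` side (`nth k = r.side W`).
* ★★ `ΩG.end_slanted_of_initial_run_through`: if the arc in `r` is straight too, a class-`B2a` walk ends on `N` or `S` (both vertical
  sides of `r` are crossed at indices `k`, `k + 1 < length`, `Mv ≥ 3`, `nth_inj`); `ΩG.end_of_initial_run_turn`: if it turns, the end
  avoids `W` and the exit side.
* ★★★ `ΩG.end_slanted_of_initial_run_cost_five`: **at limit cost `5`, a wound class-`B2a` walk whose initial run reaches the root-row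
  rhombus `r` ends on a SLANTED side of `r`** — if the arc in `r` turns, `r` is a singly visited turning plaquette strictly between
  the extreme rows, which `turn_profile_of_cost_five` allows only for a slanted end.

Census side (b-engine-1 g23/g24): every cost-`5` class-`B2a` member at a root-row cell has a straight initial run to `r`; the remaining
case — a turn before reaching `r`'s column, then a vertical first crossing of `r` and a return along the hole row — never occurs
(0 of the kit's level-`5` members end on a vertical side) and is the lane's open SLANTED-END LEMMA (planarity); not proved here.
[GlazmanManolescu2019 §1 Fig. 1, Lemma 2.1; Glazman 2015 Lemma 3.1 (proof, pp. 6–7)]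
-/

noncomputable section

namespace Literature.Probability.RandomPlanarGeometry.SAW.YangBaxter

open Real
open Literature.Barriers.CriticalPhenomena.PlaquetteWalk

open private fc_fh fc_ne fh_add_Mv three_le_Mv from Literature.Probability.RandomPlanarGeometry.YangBaxterSAWGeneralDomain

namespace YBWalk

variable {D : Set Face} {w : Face} {z : MidEdge}

/-- **The first arc of a walk from the hole root enters the root plaquette through its `W` side.** [cite: Glazman2015WeightedSAW, Lemma 3.1 (proof, pp. 6–7)] -/
theorem sIn_zero_eq_W (hh : holeFaceW w ∉ D) (γ : YBWalk D (w.side .W) z) (hn : 0 < γ.arcs.length) : γ.sIn 0 = .W := by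
  obtain ⟨hin, -⟩ := γ.side_sIn_eq_nth hn
  rw [γ.nth_zero, fc_zero_eq_root w hh γ hn] at hin
  exact Face.side_injective w hin

/-- ★ **THE INITIAL STRAIGHT RUN**: if the first `k` arcs of a walk from the hole root `w.side W` are straight, they run EAST along the hole
row — the `i`-th arc lies in `(w.1 + i, w.2)`, enters through `W` and (for `i < k`) leaves through `E` — and so does the entry of the
`k`-th arc. [cite: GlazmanManolescu2019, §1, Fig. 1 (consecutive arcs lie in adjacent rhombi)] [cite: Glazman2015WeightedSAW, Lemma 3.1 (proof, pp. 6–7)] -/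
theorem initial_run (hh : holeFaceW w ∉ D) (γ : YBWalk D (w.side .W) z) {k : ℕ} (hk : k < γ.arcs.length)
    (hstr : ∀ i < k, arcKind (γ.sIn i) (γ.sOut i) = .straight) :
    (∀ i ≤ k, γ.fc i = (w.1 + i, w.2) ∧ γ.sIn i = .W) ∧ ∀ i < k, γ.sOut i = .E := by
  have hE : ∀ i < k, γ.sIn i = .W → γ.sOut i = .E := by
    intro i hi hW
    have hs := hstr i hi
    rw [hW] at hs
    have hne := γ.sIn_ne_sOut (show i < γ.arcs.length by omega)
    rw [hW] at hne
    revert hs hne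
    cases γ.sOut i <;> decide
  have main : ∀ i ≤ k, γ.fc i = (w.1 + i, w.2) ∧ γ.sIn i = .W := by
    intro i
    induction i with
    | zero => intro _; exact ⟨by simpa using fc_zero_eq_root w hh γ (by omega), γ.sIn_zero_eq_W hh (by omega)⟩
    | succ i ih =>
      intro hi
      obtain ⟨hfc, hW⟩ := ih (by omega)
      obtain ⟨hfc', hW'⟩ := γ.fc_succ_eq_of_sOut_E (show i + 1 < γ.arcs.length by omega) (hE i (by omega) hW)
      refine ⟨?_, hW'⟩
      rw [hfc', hfc]; push_cast; ring_nf
  exact ⟨main, fun i hi => hE i hi (main i hi.le).2⟩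

end YBWalk

namespace ΩG

variable {D : Set Face} {w r : Face} {ω : ΩG D (w.side .W) r}

/-- ★ **THE FIRST HIT OF A ROOT-ROW RHOMBUS ALONG THE INITIAL RUN**: if `r = (w.1 + k, w.2)` and the first `k` arcs are straight, the walk
first crosses `∂r` at index `k`, through its `W` side. [cite: Glazman2015WeightedSAW, Lemma 3.1 (proof, pp. 6–7: the first crossing of `∂r`)] -/
theorem firstHitG_eq_of_initial_run (hh : holeFaceW w ∉ D) {k : ℕ} (hrk : r = (w.1 + k, w.2)) (hk : k < ω.2.arcs.length)
    (hstr : ∀ i < k, arcKind (ω.2.sIn i) (ω.2.sOut i) = .straight) : ω.2.firstHitG = k ∧ ω.2.nth k = r.side .W := by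
  subst hrk
  obtain ⟨hrun, hout⟩ := ω.2.initial_run hh hk hstr
  have hnthk : ω.2.nth k = Face.side (w.1 + k, w.2) .W := by
    obtain ⟨hin, -⟩ := ω.2.side_sIn_eq_nth hk
    obtain ⟨hfc, hW⟩ := hrun k le_rfl
    rw [hfc, hW] at hin; rw [← hin]
  -- `k` is a hit, so `firstHitG ≤ k`
  have hle : ω.2.firstHitG ≤ k := by
    have hmem : k ∈ ω.2.hitIdx (w.1 + k, w.2) := (YBWalk.mem_hitIdx _ _).2 ⟨hk.le, .W, hnthk⟩
    unfold YBWalk.firstHitG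
    exact Finset.min'_le _ _ hmem
  -- no earlier mid-edge is a side of `r`: `nth i` (`i ≤ k`) is the `W` side of `(w.1 + i, w.2)`
  have hge : k ≤ ω.2.firstHitG := by
    by_contra hlt
    obtain ⟨F, hFdef⟩ : ∃ F, ω.2.firstHitG = F := ⟨_, rfl⟩
    have hFk : F < k := by omega
    have hFmem : F ∈ ω.2.hitIdx (w.1 + k, w.2) := by rw [← hFdef]; unfold YBWalk.firstHitG; exact Finset.min'_mem _ _
    obtain ⟨-, s, hs⟩ := (YBWalk.mem_hitIdx _ _).1 hFmem
    obtain ⟨hin, -⟩ := ω.2.side_sIn_eq_nth (show F < ω.2.arcs.length by omega)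
    obtain ⟨hfc, hW⟩ := hrun F hFk.le
    rw [hfc, hW, hs] at hin
    -- `(w.1 + F, w.2).side W = (w.1 + k, w.2).side s` with `F < k`: impossible
    have e' : Face.side (w.1 + (k : ℤ), w.2) s = MidEdge.vert (w.1 + F) w.2 := by rw [← hin]; rfl
    rcases eq_of_side_eq_vert e' with ⟨h2, -⟩ | ⟨h2, -⟩
    · have := congrArg Prod.fst h2; simp only at this; omega
    · have := congrArg Prod.fst h2; simp only at this; omega
  exact ⟨le_antisymm hle hge, hnthk⟩

/-- ★★ **A STRAIGHT PASSAGE THROUGH `r` FORCES A SLANTED END**: if `r = (w.1 + k, w.2)` and the first `k + 1` arcs of a class-`B2a` walk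
are straight (the initial run passes through `r` from `W` to `E`), the walk ends on the `N` or the `S` side of `r` — both vertical sides are
already crossed. [cite: GlazmanManolescu2019, Lemma 2.1 (the classes of walks at a rhombus)] [cite: Glazman2015WeightedSAW, Lemma 3.1 (proof, pp. 6–7)] -/
theorem end_slanted_of_initial_run_through (hh : holeFaceW w ∉ D) (hr : RootedFace D (w.side .W) r) (h : ω.IsB2a) {k : ℕ}
    (hrk : r = (w.1 + k, w.2)) (hk : k + 1 < ω.2.arcs.length)
    (hstr : ∀ i ≤ k, arcKind (ω.2.sIn i) (ω.2.sOut i) = .straight) : ω.1 = .N ∨ ω.1 = .S := by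
  obtain ⟨hF, hnthk⟩ := firstHitG_eq_of_initial_run hh hrk (by omega) (fun i hi => hstr i hi.le)
  subst hrk
  obtain ⟨hrun, hout⟩ := ω.2.initial_run hh hk (fun i hi => hstr i (by omega))
  have hM := three_le_Mv hr h
  have hFM := fh_add_Mv h
  unfold ΩG.Mv at hM hFM
  have hnthk1 : ω.2.nth (k + 1) = Face.side (w.1 + k, w.2) .E := by
    obtain ⟨-, hout'⟩ := ω.2.side_sIn_eq_nth (show k < ω.2.arcs.length by omega)
    obtain ⟨hfc, -⟩ := hrun k (by omega)
    rw [hfc, hout k (by omega)] at hout'; rw [← hout']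
  have hz : ω.2.nth ω.2.arcs.length = Face.side (w.1 + k, w.2) ω.1 := ω.2.nth_length
  -- the end is neither the `W` side `= nth k` nor the `E` side `= nth (k+1)` (no mid-edge is crossed twice)
  have key : ∀ u, ω.1 = u → u = .N ∨ u = .S := by
    intro u hu
    cases u
    · exfalso
      have e : ω.2.nth ω.2.arcs.length = ω.2.nth k := hz.trans ((congrArg _ hu).trans hnthk.symm)
      have := ω.2.nth_inj le_rfl (by omega) e; omega
    · exfalso
      have e : ω.2.nth ω.2.arcs.length = ω.2.nth (k + 1) := hz.trans ((congrArg _ hu).trans hnthk1.symm)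
      have := ω.2.nth_inj le_rfl (by omega) e; omega
    · exact Or.inr rfl
    · exact Or.inl rfl
  exact key _ rfl

/-- ★★ **A TURN AT `r` AFTER THE INITIAL RUN**: if `r = (w.1 + k, w.2)`, the first `k` arcs are straight and the arc in `r` turns (to `S`
or `N`), then a class-`B2a` walk ends on one of the two remaining free sides: `E` or the slanted side not used — i.e. the walk is an `NS`
group member whose end is `E` or the opposite slanted side. [cite: GlazmanManolescu2019, Lemma 2.1 (the classes of walks at a rhombus)]
[cite: Glazman2015WeightedSAW, Lemma 3.1 (proof, pp. 6–7)] -/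
theorem end_of_initial_run_turn (hh : holeFaceW w ∉ D) (hr : RootedFace D (w.side .W) r) (h : ω.IsB2a) {k : ℕ}
    (hrk : r = (w.1 + k, w.2)) (hk : k + 1 < ω.2.arcs.length)
    (hstr : ∀ i < k, arcKind (ω.2.sIn i) (ω.2.sOut i) = .straight) :
    ω.1 ≠ .W ∧ ω.1 ≠ ω.2.sOut k := by
  obtain ⟨hF, hnthk⟩ := firstHitG_eq_of_initial_run hh hrk (by omega) hstr
  subst hrk
  obtain ⟨hrun, -⟩ := ω.2.initial_run hh (show k < ω.2.arcs.length by omega) hstr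
  have hM := three_le_Mv hr h
  have hFM := fh_add_Mv h
  unfold ΩG.Mv at hM hFM
  have hz : ω.2.nth ω.2.arcs.length = Face.side (w.1 + k, w.2) ω.1 := ω.2.nth_length
  obtain ⟨-, hout'⟩ := ω.2.side_sIn_eq_nth (show k < ω.2.arcs.length by omega)
  obtain ⟨hfc, -⟩ := hrun k le_rfl
  rw [hfc] at hout'
  constructor
  · intro hu
    have e : ω.2.nth ω.2.arcs.length = ω.2.nth k := hz.trans ((congrArg _ hu).trans hnthk.symm)
    have := ω.2.nth_inj le_rfl (by omega) e; omega
  · intro hu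
    have e : ω.2.nth ω.2.arcs.length = ω.2.nth (k + 1) := hz.trans ((congrArg _ hu).trans hout')
    have := ω.2.nth_inj le_rfl (by omega) e; omega

/-- ★★★ **ON THE ROOT ROW, A STRAIGHT APPROACH AT COST `5` FORCES A SLANTED END.** Let `r = (w.1 + k, w.2)` lie on the hole row east of
the root plaquette and let `ω` be a wound class-`B2a` walk of limit cost `5` whose first `k` arcs are straight (the initial run reaches `r`).
Then `ω` ends on the `N` or the `S` side of `r`: if the arc in `r` is straight both vertical sides are crossed
(`end_slanted_of_initial_run_through`); if it turns, `r` — singly visited, in the hole row strictly between the extreme rows — is an isolated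
turn in a middle row, which `turn_profile_of_cost_five` allows only when the end side is slanted. (The census: every cost-`5` class-`B2a`
member at a root-row cell is of this kind; the case of an earlier turn is the lane's open «slanted-end lemma».)
[cite: GlazmanManolescu2019, §1, Fig. 1 and eq. (1); Lemma 2.1] [cite: Glazman2015WeightedSAW, Lemma 3.1 (proof, pp. 6–7)] -/
theorem end_slanted_of_initial_run_cost_five (hh : holeFaceW w ∉ D) (hr : RootedFace D (w.side .W) r) (h : ω.IsB2a)
    (hA : ω.AJ hr h (toC (midPt (w.side .W))) ≠ 0) (hc : cost (slotOfSide ω.1) ω.2.mids = 5) {k : ℕ}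
    (hrk : r = (w.1 + k, w.2)) (hk : k < ω.2.arcs.length) (hstr : ∀ i < k, arcKind (ω.2.sIn i) (ω.2.sOut i) = .straight) :
    ω.1 = .N ∨ ω.1 = .S := by
  classical
  obtain ⟨hF, hnthk⟩ := firstHitG_eq_of_initial_run hh hrk hk hstr
  have hM := three_le_Mv hr h
  have hFM := fh_add_Mv h
  unfold ΩG.Mv at hM hFM
  by_cases hks : arcKind (ω.2.sIn k) (ω.2.sOut k) = .straight
  · exact end_slanted_of_initial_run_through hh hr h hrk (by omega) (fun i hi => by
      rcases Nat.lt_or_ge i k with hlt | hge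
      · exact hstr i hlt
      · rw [show i = k by omega]; exact hks)
  · -- `r` is a singly visited turning plaquette in the hole row
    obtain ⟨hrun, -⟩ := ω.2.initial_run hh hk hstr
    have hfck : ω.2.fc k = r := by rw [(hrun k le_rfl).1, hrk]
    have hsv : ∀ j < ω.2.arcs.length, ω.2.fc j = ω.2.fc k → j = k := by
      intro j hj he
      rcases Nat.lt_trichotomy j k with hlt | heq | hgt
      · exfalso
        have e1 := (hrun j hlt.le).1
        rw [he, hfck, hrk] at e1
        have := congrArg Prod.fst e1; simp only at this; omega
      · exact heq
      · exact absurd (he.trans hfck) (fc_ne ω hr h (by omega) hj)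
    have hP := isolated_turn hk hsv hks
    obtain ⟨Y, Y', hY'w, hYw, -, -, hprof, -⟩ := turn_profile_of_cost_five hh hr h hA hc
    have hmid := (hprof {ω.2.fc k} (fun f hf => by rw [Finset.mem_singleton.1 hf]; exact hP)).2.2
      (fun f hf => by rw [Finset.mem_singleton.1 hf, hfck, hrk]; exact ⟨by simpa using hY'w, by simpa using hYw⟩)
    rw [Finset.card_singleton] at hmid
    -- so the end slot has degree `1`: a slanted side
    have key : ∀ u, ω.1 = u → 1 ≤ slotDeg (slotOfSide u) → u = .N ∨ u = .S := by
      intro u _ hd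
      cases u
      · exact absurd hd (by decide)
      · exact absurd hd (by decide)
      · exact Or.inr rfl
      · exact Or.inl rfl
    exact key _ rfl hmid

end ΩG

end Literature.Probability.RandomPlanarGeometry.SAW.YangBaxter
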